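import Summits.SmoothPoincare4.SmoothPoincare4.Theorems.ConvexBisectionPlanarAcyclicBisectionRigidityHelperAbelianArcData
import HarnessLib

/-!
# Crux `ConvexBisection.PlanarAcyclicBisectionRigidity`, line Sketch — helper `helper_types_perm3`
# (λ-injectivity at `n = 3`: equal monodromies ⇒ equal multisets of hole types)

Item stmt-SmoothPoincare4-15086, skeleton `Cruxes/PlanarAcyclicBisectionRigidity/Lines/Sketch.lean`
v3.0 (lead c3), a step of the combinatorial stub `stub_walk3`.  Pure algebra over the registered word
calculus `Literature.Topology.FourManifolds.PlanarWords` and the landed abelianised arc data `AbArc`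
(`…HelperAbelianArcData.lean`); nothing topological is assumed, no named fact is used.

* `helper_types_perm3`: two positive factorisations `A`, `B` (three in-range curves each) of ONE
  mapping class of the disc with three holes have the same multiset of HOLE TYPES
  `typeVec 3 c ∈ {0,1}³ ∖ {0}`.  Proof (sub-namespace `TypesPerm`, Möbius inversion): equal
  monodromies give equal Gram sums `N_{ij} = Σ_{c} sᵢ(c) sⱼ(c)` (`AbArc.gram_eq_of_monodromy_eq`);
  for a nonzero `0/1` vector `s ∈ ℤ³` and a `0/1` vector `t` the indicator `[s = t]` is an explicit
  AFFINE combination of `1` and the products `sᵢ sⱼ` with coefficients polynomial in `t`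
  (`ite_eq_gramPoly`: the multilinear expansion of `∏ᵢ (sᵢtᵢ + (1-sᵢ)(1-tᵢ))` with the cubic term
  `s₀s₁s₂ = 1 - Σ sᵢ + Σ_{i<j} sᵢsⱼ` eliminated by `∏ᵢ (1 - sᵢ) = 0`; checked by `decide` over the
  `2⁶` Boolean cases); summing over the list, the multiplicity `count t L` of every `t` is the same
  affine combination of `|L|` and the Gram sums of `L` (`sum_map_affine`, `count_eq_sum_ite`), so
  equal lengths and equal Gram sums give equal multiplicities, i.e. a permutation
  (`List.perm_iff_count`; vectors that are not `0/1` occur in neither list) — `perm_of_gram_eq`,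
  valid for lists of any (equal) length.
* `typeVec_eq_of_twist_eq`: the hole type of a curve is determined by (the arc data of) its positive
  Dehn twist — read `AbArc.ev_u_twist`, `ev (u_i(T_c)) = 𝟙[i ∈ type c] · typeVec c`, at the
  coordinate `i` itself: `(𝟙[i ∈ type c] · typeVec c)ᵢ = (typeVec c)ᵢ` for a `0/1` vector
  (`AbArc.typeVec_eq_of_twist_eval_eq`, any number of holes, no range hypothesis needed).
-/

open Literature.Topology.FourManifolds Literature.Topology.FourManifolds.PlanarWords

-- the prescribed namespace `Summit.<S>.<P>.…` repeats `SmoothPoincare4` (S = P = SmoothPoincare4)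
set_option linter.dupNamespace false

namespace Summit.SmoothPoincare4.SmoothPoincare4.Theorems.PlanarAcyclicBisectionRigidity.Sketch

namespace TypesPerm

open GramSpan

/-! ## The indicator `[s = t]` of a nonzero `0/1` vector of `ℤ³` is affine in the products `sᵢ sⱼ` -/

/-- Brute force over `2⁶` Boolean cases: for a NONZERO `0/1` vector `(s₀, s₁, s₂)` and a `0/1`
vector `(t₀, t₁, t₂)`, the indicator `[s = t]` is an explicit affine combination of the products
`sᵢ sⱼ` with coefficients polynomial in `t` — the multilinear expansion of
`∏ᵢ (sᵢ tᵢ + (1 - sᵢ)(1 - tᵢ)) = ∏ᵢ ((1 - tᵢ) + (2tᵢ - 1) sᵢ)` with the cubic monomial replaced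
through `s₀s₁s₂ = 1 - Σᵢ sᵢ + Σ_{i<j} sᵢsⱼ` (i.e. `∏ᵢ (1 - sᵢ) = 0`, `s ≠ 0`). [folklore] -/
theorem ite_and_eq_gramPoly {s0 s1 s2 t0 t1 t2 : ℤ}
    (hs0 : s0 = 0 ∨ s0 = 1) (hs1 : s1 = 0 ∨ s1 = 1) (hs2 : s2 = 0 ∨ s2 = 1)
    (hne : ¬(s0 = 0 ∧ s1 = 0 ∧ s2 = 0))
    (ht0 : t0 = 0 ∨ t0 = 1) (ht1 : t1 = 0 ∨ t1 = 1) (ht2 : t2 = 0 ∨ t2 = 1) :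
    (if s0 = t0 ∧ s1 = t1 ∧ s2 = t2 then (1 : ℤ) else 0) =
      ((1 - t0) * (1 - t1) * (1 - t2) + (2 * t0 - 1) * (2 * t1 - 1) * (2 * t2 - 1))
      + ((2 * t0 - 1) * (1 - t1) * (1 - t2) - (2 * t0 - 1) * (2 * t1 - 1) * (2 * t2 - 1)) * (s0 * s0)
      + ((1 - t0) * (2 * t1 - 1) * (1 - t2) - (2 * t0 - 1) * (2 * t1 - 1) * (2 * t2 - 1)) * (s1 * s1)
      + ((1 - t0) * (1 - t1) * (2 * t2 - 1) - (2 * t0 - 1) * (2 * t1 - 1) * (2 * t2 - 1)) * (s2 * s2)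
      + ((2 * t0 - 1) * (2 * t1 - 1) * (1 - t2) + (2 * t0 - 1) * (2 * t1 - 1) * (2 * t2 - 1)) * (s0 * s1)
      + ((2 * t0 - 1) * (1 - t1) * (2 * t2 - 1) + (2 * t0 - 1) * (2 * t1 - 1) * (2 * t2 - 1)) * (s0 * s2)
      + ((1 - t0) * (2 * t1 - 1) * (2 * t2 - 1) + (2 * t0 - 1) * (2 * t1 - 1) * (2 * t2 - 1)) * (s1 * s2) := by
  obtain ⟨b0, rfl⟩ := exists_bool_of_zero_or_one hs0
  obtain ⟨b1, rfl⟩ := exists_bool_of_zero_or_one hs1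
  obtain ⟨b2, rfl⟩ := exists_bool_of_zero_or_one hs2
  obtain ⟨c0, rfl⟩ := exists_bool_of_zero_or_one ht0
  obtain ⟨c1, rfl⟩ := exists_bool_of_zero_or_one ht1
  obtain ⟨c2, rfl⟩ := exists_bool_of_zero_or_one ht2
  clear hs0 hs1 hs2 ht0 ht1 ht2
  revert hne b0 b1 b2 c0 c1 c2
  decide

/-- The indicator `[s = t]` of a nonzero `0/1` vector `s ∈ ℤ³` against a `0/1` vector `t`, as an
affine combination of the Gram monomials `sᵢ sⱼ` (function form of `ite_and_eq_gramPoly`).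
[folklore] -/
theorem ite_eq_gramPoly (s t : Fin 3 → ℤ) (hs : ∀ i, s i = 0 ∨ s i = 1) (hs0 : s ≠ 0)
    (ht : ∀ i, t i = 0 ∨ t i = 1) :
    (if s = t then (1 : ℤ) else 0) =
      ((1 - t 0) * (1 - t 1) * (1 - t 2) + (2 * t 0 - 1) * (2 * t 1 - 1) * (2 * t 2 - 1))
      + ((2 * t 0 - 1) * (1 - t 1) * (1 - t 2) - (2 * t 0 - 1) * (2 * t 1 - 1) * (2 * t 2 - 1))
        * (s 0 * s 0)
      + ((1 - t 0) * (2 * t 1 - 1) * (1 - t 2) - (2 * t 0 - 1) * (2 * t 1 - 1) * (2 * t 2 - 1))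
        * (s 1 * s 1)
      + ((1 - t 0) * (1 - t 1) * (2 * t 2 - 1) - (2 * t 0 - 1) * (2 * t 1 - 1) * (2 * t 2 - 1))
        * (s 2 * s 2)
      + ((2 * t 0 - 1) * (2 * t 1 - 1) * (1 - t 2) + (2 * t 0 - 1) * (2 * t 1 - 1) * (2 * t 2 - 1))
        * (s 0 * s 1)
      + ((2 * t 0 - 1) * (1 - t 1) * (2 * t 2 - 1) + (2 * t 0 - 1) * (2 * t 1 - 1) * (2 * t 2 - 1))
        * (s 0 * s 2)
      + ((1 - t 0) * (2 * t 1 - 1) * (2 * t 2 - 1) + (2 * t 0 - 1) * (2 * t 1 - 1) * (2 * t 2 - 1))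
        * (s 1 * s 2) := by
  have hst : s = t ↔ s 0 = t 0 ∧ s 1 = t 1 ∧ s 2 = t 2 :=
    ⟨fun h => by subst h; exact ⟨rfl, rfl, rfl⟩,
      fun h => funext fun i => by fin_cases i; exacts [h.1, h.2.1, h.2.2]⟩
  have hne : ¬(s 0 = 0 ∧ s 1 = 0 ∧ s 2 = 0) := fun h =>
    hs0 (funext fun i => by fin_cases i; exacts [h.1, h.2.1, h.2.2])
  simp only [hst]
  exact ite_and_eq_gramPoly (hs 0) (hs 1) (hs 2) hne (ht 0) (ht 1) (ht 2)

/-! ## Summing over a list: multiplicities from Gram sums -/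

/-- A function that is affine in the Gram monomials `sᵢ sⱼ` on every member of a list `L ⊆ ℤ³` sums
over `L` to the same affine combination of `|L|` and the Gram sums of `L`. [folklore] -/
theorem sum_map_affine (L : List (Fin 3 → ℤ)) (f : (Fin 3 → ℤ) → ℤ)
    {kc k0 k1 k2 k01 k02 k12 : ℤ}
    (hf : ∀ s ∈ L, f s = kc + k0 * (s 0 * s 0) + k1 * (s 1 * s 1) + k2 * (s 2 * s 2)
      + k01 * (s 0 * s 1) + k02 * (s 0 * s 2) + k12 * (s 1 * s 2)) :
    (L.map f).sum = kc * L.length + k0 * (L.map fun s => s 0 * s 0).sum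
      + k1 * (L.map fun s => s 1 * s 1).sum + k2 * (L.map fun s => s 2 * s 2).sum
      + k01 * (L.map fun s => s 0 * s 1).sum + k02 * (L.map fun s => s 0 * s 2).sum
      + k12 * (L.map fun s => s 1 * s 2).sum := by
  induction L with
  | nil => simp
  | cons s L ih =>
      simp only [List.map_cons, List.sum_cons, List.length_cons, Nat.cast_add, Nat.cast_one]
      rw [ih fun s' hs' => hf s' (List.mem_cons_of_mem s hs'), hf s List.mem_cons_self]
      ring

/-- The multiplicity of `t` in `L`, as the sum of the indicators `[s = t]`, `s ∈ L`. [folklore] -/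
theorem count_eq_sum_ite {α : Type*} [DecidableEq α] (L : List α) (t : α) :
    (L.count t : ℤ) = (L.map fun s => if s = t then (1 : ℤ) else 0).sum := by
  induction L with
  | nil => simp
  | cons s L ih =>
      rw [List.count_cons, Nat.cast_add, ih, List.map_cons, List.sum_cons, add_comm]
      congr 1
      by_cases h : s = t
      · subst h; simp
      · simp [h]

/-- **Möbius inversion on three holes.**  Two lists of nonzero `0/1` vectors of `ℤ³` of the same
length with the same Gram sums `Σ_{s} sᵢ sⱼ` are permutations of each other: the multiplicity of
each of the seven possible members is the same affine combination of the length and the Gram sums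
on both sides (`ite_eq_gramPoly`, `sum_map_affine`), and nothing else occurs. [folklore] -/
theorem perm_of_gram_eq (sA sB : List (Fin 3 → ℤ)) (hlen : sA.length = sB.length)
    (h01 : ∀ s ∈ sA ++ sB, ∀ i, s i = 0 ∨ s i = 1) (hne : ∀ s ∈ sA ++ sB, s ≠ 0)
    (hgram : ∀ i j : Fin 3, (sA.map fun s => s i * s j).sum = (sB.map fun s => s i * s j).sum) :
    sA.Perm sB := by
  rw [List.perm_iff_count]
  intro t
  by_cases ht : ∀ i, t i = 0 ∨ t i = 1
  · -- `t` is a `0/1` vector: both multiplicities are the same function of the Gram data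
    have hA := (count_eq_sum_ite sA t).trans (sum_map_affine sA _ fun s hs =>
      ite_eq_gramPoly s t (h01 s (List.mem_append_left sB hs)) (hne s (List.mem_append_left sB hs)) ht)
    have hB := (count_eq_sum_ite sB t).trans (sum_map_affine sB _ fun s hs =>
      ite_eq_gramPoly s t (h01 s (List.mem_append_right sA hs)) (hne s (List.mem_append_right sA hs))
        ht)
    rw [hlen, hgram, hgram, hgram, hgram, hgram, hgram, ← hB] at hA
    exact_mod_cast hA
  · -- `t` is not a `0/1` vector: it occurs in neither list
    rw [List.count_eq_zero.2 fun h => ht (h01 t (List.mem_append_left sB h)),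
      List.count_eq_zero.2 fun h => ht (h01 t (List.mem_append_right sA h))]

end TypesPerm

namespace AbArc

/-- **The hole type of a curve is determined by its positive Dehn twist** (any number of holes, no
range hypothesis): `ev (u_i(T_c)) = 𝟙[i ∈ type c] · typeVec c` (`ev_u_twist`) read at the
coordinate `i` is `(typeVec c)ᵢ` itself, the type vector being `0/1`-valued. [folklore] -/
theorem typeVec_eq_of_twist_eval_eq {n : ℕ} (c d : PlanarCurve)
    (h : evalWord n (c.twistWord true) = evalWord n (d.twistWord true)) :
    typeVec n c = typeVec n d := by
  have key : ∀ (e : PlanarCurve) (i : Fin n),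
      typeVec n e i = (if typeVec n e i = 1 then typeVec n e else 0) i := by
    intro e i
    rcases typeVec_zero_or_one e i with h0 | h1
    · rw [h0, if_neg (by norm_num)]; rfl
    · rw [if_pos h1]
  funext i
  rw [key c i, key d i, ← ev_u_twist c i, ← ev_u_twist d i, h]

end AbArc

open AbArc in
/-- **Helper `helper_types_perm3` (registered stub, skeleton v3.0) — λ-injectivity at `n = 3`.**
Two positive factorisations `A`, `B`, three in-range curves each, of ONE mapping class of the disc
with three holes (equal arc data `monodromy`) have the same multiset of hole types: equal
monodromies give equal Gram sums of the (nonzero, `0/1`) type vectors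
(`AbArc.gram_eq_of_monodromy_eq`), and on three holes the Gram sums and the number of curves
determine every multiplicity (`TypesPerm.perm_of_gram_eq`, Möbius inversion). [folklore] -/
theorem helper_types_perm3 (A B : List PlanarCurve) (hin : ∀ c ∈ A ++ B, c.InRange 3)
    (hA : A.length = 3) (hB : B.length = 3)
    (hmon : monodromy 3 (positiveWord A) = monodromy 3 (positiveWord B)) :
    (A.map (AbArc.typeVec 3)).Perm (B.map (AbArc.typeVec 3)) := by
  refine TypesPerm.perm_of_gram_eq _ _ (by simp [hA, hB]) ?_ ?_ (gram_eq_of_monodromy_eq A B hmon)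
  · intro s hs i
    rw [← List.map_append, List.mem_map] at hs
    obtain ⟨c, -, rfl⟩ := hs
    exact typeVec_zero_or_one c i
  · intro s hs
    rw [← List.map_append, List.mem_map] at hs
    obtain ⟨c, hc, rfl⟩ := hs
    exact typeVec_ne_zero c (hin c hc)

/-- **The hole type is determined by the twist** (three holes, in-range curves; the form consumed
by `stub_walk3`): if the positive Dehn twists about `c` and `d` have the same arc data then
`typeVec 3 c = typeVec 3 d` — specialisation of `AbArc.typeVec_eq_of_twist_eval_eq` (the range
hypotheses `_hc`, `_hd` of the consumer's call shape are redundant and unused). [folklore] -/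
theorem typeVec_eq_of_twist_eq (c d : PlanarCurve) (_hc : c.InRange 3) (_hd : d.InRange 3)
    (h : evalWord 3 (c.twistWord true) = evalWord 3 (d.twistWord true)) :
    AbArc.typeVec 3 c = AbArc.typeVec 3 d :=
  AbArc.typeVec_eq_of_twist_eval_eq c d h

end Summit.SmoothPoincare4.SmoothPoincare4.Theorems.PlanarAcyclicBisectionRigidity.Sketch
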